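import Summits.CriticalPhenomena.CardyFormulaZ2.Theorems.CardySelfRefinementCriticalPathRSWStubFiniteSizeCriteriaGeometry

/-!
# Finite-size criteria for `M_k`, part 5: the self-refinement measure satisfies the hypotheses

Support file for item `stmt-CriticalPhenomena-10267` (route `CardySelfRefinement`, crux
`CriticalPathRSW`, line finite-size-envelope, stub `stub_finiteSizeCriteria`): the finite-size
criteria (H. Kesten, *Percolation theory for mathematicians* (1982), Ch. 5, Thm. 5.1; G. Grimmett,
*Percolation* (1999), §11.7) for the `k`-dependent self-refinement laws `M_k(ρ, c)` and their duals.

`M_k(ρ, c)` is a.s. a lattice configuration and invariant under `kℤ²` and the transposition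
(tree, `SelfRefinementMeasure.lean`); here we prove its **finite-range independence**: events
determined by the pairs of vertices of two finite sets at sup-distance `> k` are independent
(`selfRefinementMeasure_real_inter_eq`).  The coins read by an edge `(v, d)` are its own coin
`(v, d, 0)` and the shared coin / selector `(⌊v/k⌋, d, 1/2)` of its tuple, and `⌊v/k⌋ = ⌊v'/k⌋`
forces `‖v - v'‖∞ < k`; independence over disjoint coin sets is the tree's
`prodBernoulli_real_inter_of_determinedBy_disjoint`.
-/

noncomputable section

namespace Summit.CriticalPhenomena.CardyFormulaZ2.Cruxes.CriticalPathRSW.FiniteSizeEnvelope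

open Set
open Literature.Probability.LatticeModels Literature.Probability.Percolation

namespace FSC

/-! ### Rectangles and crossing events (local notations)

To keep these support files free of new definitions, the four events of the argument are local
notations for explicit instances of the tree's `openCrossing S A B`:

* `rect[a, b, lo, hi]` — the lattice rectangle `[a, b] × [lo, hi] ∩ ℤ²` (a `Finset`, Mathlib's
  order interval of `Site 2 = Fin 2 → ℤ`);
* `hCross[a, b, lo, hi]` — its **horizontal open crossing**: an open path inside the rectangle from
  the left side `{x₀ = a}` to the right side `{x₀ = b}`;
* `vCross[a, b, lo, hi]` — its **vertical open crossing**, from `{x₁ = lo}` to `{x₁ = hi}`;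
* `annulusCross[c, N, R]` — the **annulus event** `A(c; N, R)` of Kesten (1982), Ch. 5: an open
  path inside the box `c + [-R, R]²` from the box `c + [-N, N]²` to the boundary of `c + [-R, R]²`. -/

local notation3 "rect[" a ", " b ", " lo ", " hi "]" =>
  (Finset.Icc ![(a : ℤ), (lo : ℤ)] ![(b : ℤ), (hi : ℤ)] : Finset (Site 2))

local notation3 "hCross[" a ", " b ", " lo ", " hi "]" =>
  (openCrossing (↑(Finset.Icc ![(a : ℤ), (lo : ℤ)] ![(b : ℤ), (hi : ℤ)] : Finset (Site 2)) : Set (Site 2))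
    {x : Site 2 | x ∈ (Finset.Icc ![(a : ℤ), (lo : ℤ)] ![(b : ℤ), (hi : ℤ)] : Finset (Site 2)) ∧ x 0 = (a : ℤ)}
    {x : Site 2 | x ∈ (Finset.Icc ![(a : ℤ), (lo : ℤ)] ![(b : ℤ), (hi : ℤ)] : Finset (Site 2)) ∧ x 0 = (b : ℤ)} :
    Set (BondConfig (Site 2)))

local notation3 "vCross[" a ", " b ", " lo ", " hi "]" =>
  (openCrossing (↑(Finset.Icc ![(a : ℤ), (lo : ℤ)] ![(b : ℤ), (hi : ℤ)] : Finset (Site 2)) : Set (Site 2))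
    {x : Site 2 | x ∈ (Finset.Icc ![(a : ℤ), (lo : ℤ)] ![(b : ℤ), (hi : ℤ)] : Finset (Site 2)) ∧ x 1 = (lo : ℤ)}
    {x : Site 2 | x ∈ (Finset.Icc ![(a : ℤ), (lo : ℤ)] ![(b : ℤ), (hi : ℤ)] : Finset (Site 2)) ∧ x 1 = (hi : ℤ)} :
    Set (BondConfig (Site 2)))

local notation3 "annulusCross[" c ", " N ", " R "]" =>
  (openCrossing
    (↑(Finset.Icc ![(c : Site 2) 0 - ((R : ℕ) : ℤ), (c : Site 2) 1 - ((R : ℕ) : ℤ)]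
        ![(c : Site 2) 0 + ((R : ℕ) : ℤ), (c : Site 2) 1 + ((R : ℕ) : ℤ)] : Finset (Site 2)) : Set (Site 2))
    (↑(Finset.Icc ![(c : Site 2) 0 - ((N : ℕ) : ℤ), (c : Site 2) 1 - ((N : ℕ) : ℤ)]
        ![(c : Site 2) 0 + ((N : ℕ) : ℤ), (c : Site 2) 1 + ((N : ℕ) : ℤ)] : Finset (Site 2)) : Set (Site 2))
    {x : Site 2 | x ∈ (Finset.Icc ![(c : Site 2) 0 - ((R : ℕ) : ℤ), (c : Site 2) 1 - ((R : ℕ) : ℤ)]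
        ![(c : Site 2) 0 + ((R : ℕ) : ℤ), (c : Site 2) 1 + ((R : ℕ) : ℤ)] : Finset (Site 2)) ∧
      (x 0 = (c : Site 2) 0 - ((R : ℕ) : ℤ) ∨ x 0 = (c : Site 2) 0 + ((R : ℕ) : ℤ) ∨
        x 1 = (c : Site 2) 1 - ((R : ℕ) : ℤ) ∨ x 1 = (c : Site 2) 1 + ((R : ℕ) : ℤ))} :
    Set (BondConfig (Site 2)))


/-! ## The self-refinement measure satisfies the hypotheses

`M_k(ρ, c)` is a.s. a lattice configuration, invariant under `kℤ²` and the transposition (tree),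
and events determined by boxes at sup-distance `> k` are independent: the coins read by an edge
`(v, d)` are its own coin `(v, d, 0)` and the shared coin / selector `(⌊v/k⌋, d, 1/2)` of its tuple,
and `⌊v/k⌋ = ⌊v'/k⌋` forces `‖v - v'‖∞ < k`. -/

section Primal

open MeasureTheory

/-- Equal integer quotients by `k > 0` force a difference `< k`. -/
theorem abs_sub_lt_of_ediv_eq {k : ℕ} (hk : 0 < k) {a b : ℤ} (h : a / k = b / k) :
    a - b < k ∧ b - a < k := by
  have hk' : (0 : ℤ) < k := by exact_mod_cast hk
  have ha := Int.mul_ediv_add_emod a k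
  have hb := Int.mul_ediv_add_emod b k
  have ha1 := Int.emod_nonneg a hk'.ne'
  have ha2 := Int.emod_lt_of_pos a hk'
  have hb1 := Int.emod_nonneg b hk'.ne'
  have hb2 := Int.emod_lt_of_pos b hk'
  rw [h] at ha
  constructor <;> linarith

/-- **The coins read inside a finite set of vertices.** The preimage under the configuration map
`refinementConfig k` of an event determined by the pairs of vertices of `W` is determined by the
own coins, shared coins and selectors of the edges with lower endpoint in `W`. -/
theorem determinedBy_preimage_refinementConfig (k : ℕ) (W : Finset (Site 2))
    {C : Set (BondConfig (Site 2))} (hC : DeterminedBy C ↑W.sym2) :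
    DeterminedBy (refinementConfig k ⁻¹' C)
      ↑((W ×ˢ (Finset.univ : Finset (Fin 2))).biUnion fun vd : Site 2 × Fin 2 =>
        ({(vd.1, vd.2, (0 : Fin 3)), (tupleBase k vd, vd.2, (1 : Fin 3)),
          (tupleBase k vd, vd.2, (2 : Fin 3))} : Finset (Site 2 × Fin 2 × Fin 3))) := by
  classical
  rw [determinedBy_iff] at hC ⊢
  intro S S' hSS'
  simp only [Set.mem_preimage]
  apply hC
  -- the two configurations agree on the pairs of vertices of `W`
  have hcoin : ∀ vd : Site 2 × Fin 2, vd.1 ∈ W →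
      ((vd.1, vd.2, (0 : Fin 3)) ∈ S ↔ (vd.1, vd.2, (0 : Fin 3)) ∈ S') ∧
      ((tupleBase k vd, vd.2, (1 : Fin 3)) ∈ S ↔ (tupleBase k vd, vd.2, (1 : Fin 3)) ∈ S') ∧
      ((tupleBase k vd, vd.2, (2 : Fin 3)) ∈ S ↔ (tupleBase k vd, vd.2, (2 : Fin 3)) ∈ S') := by
    intro vd hv
    have key : ∀ x : Site 2 × Fin 2 × Fin 3,
        x ∈ ({(vd.1, vd.2, (0 : Fin 3)), (tupleBase k vd, vd.2, (1 : Fin 3)),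
          (tupleBase k vd, vd.2, (2 : Fin 3))} : Finset (Site 2 × Fin 2 × Fin 3)) → (x ∈ S ↔ x ∈ S') := by
      intro x hx
      have hxF : x ∈ (↑((W ×ˢ (Finset.univ : Finset (Fin 2))).biUnion fun vd : Site 2 × Fin 2 =>
          ({(vd.1, vd.2, (0 : Fin 3)), (tupleBase k vd, vd.2, (1 : Fin 3)),
            (tupleBase k vd, vd.2, (2 : Fin 3))} : Finset (Site 2 × Fin 2 × Fin 3))) :
            Set (Site 2 × Fin 2 × Fin 3)) := by
        rw [Finset.coe_biUnion, Set.mem_iUnion₂]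
        exact ⟨vd, Finset.mem_coe.2 (Finset.mem_product.2 ⟨hv, Finset.mem_univ _⟩), hx⟩
      constructor
      · intro h
        exact ((Set.ext_iff.1 hSS' x).1 ⟨h, hxF⟩).1
      · intro h
        exact ((Set.ext_iff.1 hSS' x).2 ⟨h, hxF⟩).1
    exact ⟨key _ (by simp), key _ (by simp), key _ (by simp)⟩
  ext e
  simp only [Set.mem_inter_iff, Finset.mem_coe]
  constructor
  · rintro ⟨he, heW⟩
    refine ⟨?_, heW⟩
    obtain ⟨vd, rfl⟩ := mem_edgeSet_iff_exists_cornerEdge.1 (refinementConfig_subset_edgeSet k S he)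
    have hv : vd.1 ∈ W := Finset.mem_sym2_iff.1 heW vd.1 (by simp [cornerEdge])
    obtain ⟨h0, h1, h2⟩ := hcoin vd hv
    rw [cornerEdge_mem_refinementConfig_iff] at he ⊢
    simp only [RefinementOpen] at he ⊢
    rw [← h0, ← h1, ← h2]
    exact he
  · rintro ⟨he, heW⟩
    refine ⟨?_, heW⟩
    obtain ⟨vd, rfl⟩ := mem_edgeSet_iff_exists_cornerEdge.1 (refinementConfig_subset_edgeSet k S' he)
    have hv : vd.1 ∈ W := Finset.mem_sym2_iff.1 heW vd.1 (by simp [cornerEdge])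
    obtain ⟨h0, h1, h2⟩ := hcoin vd hv
    rw [cornerEdge_mem_refinementConfig_iff] at he ⊢
    simp only [RefinementOpen] at he ⊢
    rw [h0, h1, h2]
    exact he

/-- **Separated boxes read disjoint coins**: if every vertex of `U` is at sup-distance `> k` from
every vertex of `V`, the coins read inside `U` and inside `V` are disjoint (`k > 0`). -/
theorem disjoint_coins {k : ℕ} (hk : 0 < k) {U V : Finset (Site 2)}
    (hsep : ∀ u ∈ U, ∀ v ∈ V, (k : ℤ) < |u 0 - v 0| ∨ (k : ℤ) < |u 1 - v 1|) :
    Disjoint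
      ((U ×ˢ (Finset.univ : Finset (Fin 2))).biUnion fun vd : Site 2 × Fin 2 =>
        ({(vd.1, vd.2, (0 : Fin 3)), (tupleBase k vd, vd.2, (1 : Fin 3)),
          (tupleBase k vd, vd.2, (2 : Fin 3))} : Finset (Site 2 × Fin 2 × Fin 3)))
      ((V ×ˢ (Finset.univ : Finset (Fin 2))).biUnion fun vd : Site 2 × Fin 2 =>
        ({(vd.1, vd.2, (0 : Fin 3)), (tupleBase k vd, vd.2, (1 : Fin 3)),
          (tupleBase k vd, vd.2, (2 : Fin 3))} : Finset (Site 2 × Fin 2 × Fin 3))) := by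
  classical
  rw [Finset.disjoint_left]
  intro x hxU hxV
  rw [Finset.mem_biUnion] at hxU hxV
  obtain ⟨ud, hud, hxu⟩ := hxU
  obtain ⟨vd, hvd, hxv⟩ := hxV
  rw [Finset.mem_product] at hud hvd
  have hfar := hsep ud.1 hud.1 vd.1 hvd.1
  -- same tuple base forces closeness
  have hclose : tupleBase k ud = tupleBase k vd → False := by
    intro h
    have h0 := abs_sub_lt_of_ediv_eq hk (congr_fun h 0)
    have h1 := abs_sub_lt_of_ediv_eq hk (congr_fun h 1)
    rw [lt_abs, lt_abs] at hfar
    omega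
  have hsame : ud.1 = vd.1 → False := by
    intro h
    rw [h, sub_self, sub_self, abs_zero] at hfar
    omega
  simp only [Finset.mem_insert, Finset.mem_singleton] at hxu hxv
  rcases hxu with rfl | rfl | rfl <;> rcases hxv with h | h | h <;>
    simp only [Prod.mk.injEq, Fin.isValue] at h
  · exact hsame h.1
  · exact absurd h.2.2 (by decide)
  · exact absurd h.2.2 (by decide)
  · exact absurd h.2.2 (by decide)
  · exact hclose h.1
  · exact absurd h.2.2 (by decide)
  · exact absurd h.2.2 (by decide)
  · exact absurd h.2.2 (by decide)
  · exact hclose h.1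

/-- **Finite-range independence of `M_k(ρ, c)`**: events determined by the pairs of vertices of two
finite sets at sup-distance `> k` are independent (`k > 0`):
`M_k(A ∩ B) = M_k(A) · M_k(B)`. -/
theorem selfRefinementMeasure_real_inter_eq {k : ℕ} (hk : 0 < k) (ρ c : ℝ) (U V : Finset (Site 2))
    (hsep : ∀ u ∈ U, ∀ v ∈ V, (k : ℤ) < |u 0 - v 0| ∨ (k : ℤ) < |u 1 - v 1|)
    (A B : Set (BondConfig (Site 2))) (hA : DeterminedBy A ↑U.sym2) (hB : DeterminedBy B ↑V.sym2)
    (hAm : MeasurableSet A) (hBm : MeasurableSet B) :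
    (selfRefinementMeasure k ρ c).real (A ∩ B) =
      (selfRefinementMeasure k ρ c).real A * (selfRefinementMeasure k ρ c).real B := by
  classical
  rw [selfRefinementMeasure_real_apply k ρ c (hAm.inter hBm), selfRefinementMeasure_real_apply k ρ c hAm,
    selfRefinementMeasure_real_apply k ρ c hBm, Set.preimage_inter]
  exact prodBernoulli_real_inter_of_determinedBy_disjoint _ (disjoint_coins hk hsep)
    (determinedBy_preimage_refinementConfig k U hA) (determinedBy_preimage_refinementConfig k V hB)
    (measurable_refinementConfig k hAm) (measurable_refinementConfig k hBm)

/-- **Headline of this support file** (registered sub-stub `stub_finiteSizeCriteria_primal` of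
`stub_finiteSizeCriteria`): the finite-range independence of `M_k(ρ, c)` (`selfRefinementMeasure_real_inter_eq`). -/
theorem stub_finiteSizeCriteria_primal :
    ∀ (k : ℕ), 0 < k → ∀ (ρ c : ℝ) (U V : Finset (Site 2)), (∀ u ∈ U, ∀ v ∈ V, (k : ℤ) < |u 0 - v 0| ∨ (k : ℤ) < |u 1 - v 1|) → ∀ (A B : Set (BondConfig (Site 2))), DeterminedBy A ↑U.sym2 → DeterminedBy B ↑V.sym2 → MeasurableSet A → MeasurableSet B → (selfRefinementMeasure k ρ c).real (A ∩ B) = (selfRefinementMeasure k ρ c).real A * (selfRefinementMeasure k ρ c).real B :=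
  fun _ hk ρ c U V hsep A B hA hB hAm hBm =>
    selfRefinementMeasure_real_inter_eq hk ρ c U V hsep A B hA hB hAm hBm

end Primal

end FSC

end Summit.CriticalPhenomena.CardyFormulaZ2.Cruxes.CriticalPathRSW.FiniteSizeEnvelope
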